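import Summits.BirchSwinnertonDyer.Rank1Residual.X12.JZeroThreeTorsionCriterion
import Summits.BirchSwinnertonDyer.Rank1Residual.X12.O11.RamifiedStrictDescentAtThreeLeaf
import Summits.BirchSwinnertonDyer.BirchSwinnertonDyer.Theorems.PrintCFramJZeroThreeTraceFormBadPrimes
import Summits.BirchSwinnertonDyer.Rank1Residual.GaloisImage.PadicSquareClass
import Literature.NumberTheory.Congruences.QuadraticCharactersMinusThreeAndFive
import Literature.NumberTheory.EllipticCurves.MordellCurveSupersingular
import HarnessLib

/-!
# Route PrintCFram, crux C1 `CMRamifiedThreeBSD` — the AWAY BINDER (Av)₃ of the `3`-frame as a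
# CONGRUENCE on the Mordell coefficient: regime N versus regime V of a `j = 0` class decided by name
# (cell `bsd-print-cfram`, seat p4 g3; supports stmt-BirchSwinnertonDyer-20698)

HONEST FRAMING (cell `bsd-print-cfram`, run/shared/lean/pub/bsd-print-cfram/, D-0131 (2) print
tier; verbatim in every file of the seat): the cell works the partition leaf
`CornerF ∧ p ramified in the CM field K` (LADDER-BSD row K7r = B13; W-ALL row 12r) in PARTITION
currency — a leaf or a cell counts only when its theorem is in the kernel BY NAME. Nothing is
closed here. This file is STRUCTURE for the planner's regime split of C1 (route PrintCFram rev 6: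
N `TorsionFreeFrameBSDThree` 20698 / T `LocalThreeTorsionBSDThree` 20699 / V
`SplitPlaceTorsionBSDThree` 20700). ty2's curve-by-curve consumer at `3`
(`X12.O11.bsdp_three_of_ellipticUnitIndexAtThree`, p543426) carries, besides the two `ℚ₃`-torsion
binders `htors`/`htw` (decided by this seat's congruence `X12.JZeroThree.noThreeTorsion_pair_iff_of_mordell_model`,
p546152), the AWAY binder
`hℓ : ∀ ℓ ≠ 3 prime, √−3 ∈ ℚ_ℓ → W bad at ℓ → W(ℚ_ℓ)[3] = 0`
(which ty2's `away_three_of_padic` turns into the frame's degree-one input (Av)₃). THIS FILE DECIDES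
`hℓ` for every `j = 0` curve from its Mordell coefficient: for `W ≅ y² = x³ + k`, `k ∈ ℤ ∖ {0}`,

  `hℓ` ⟸ for every prime `ℓ ≡ 1 (mod 3)` dividing `k`: `v_ℓ(k)` is odd, or `k/ℓ^{v_ℓ(k)}` is a
  quadratic NON-residue mod `ℓ`  (`away_binder_of_mordell_model`),

because at such `ℓ` (`√−3 ∈ ℚ_ℓ ⟺ ℓ ≡ 1 (mod 3)`, `ℓ ≠ 2, 3`) a point of order `3` on `y² = x³ + k`
over `ℚ_ℓ` exists iff `k ∈ ℚ_ℓײ` (the second kind of `3`-torsion point needs `√(−3k)`, i.e. again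
`√k`), iff `v_ℓ(k)` is even and the unit part is a residue (Hensel); and a bad `ℓ ≠ 2, 3` divides `k`
(`y² = x³ + k` is good at `ℓ ∤ 6k`). Conversely (`vWitness_of_mordell_model`): if `ℓ ≡ 1 (mod 3)`,
`ℓ² ∥ k` or `ℓ⁴ ∥ k` and `k/ℓ^v` is a residue, then `W` is BAD at `ℓ` (Tate: type IV / IV*,
`not_hasGoodReductionAtPrime_of_dvd_mordell`) and `W(ℚ_ℓ)[3] ≠ 0` — the regime-V witness at `ℓ`
(`3 ∣ c_ℓ(W) = 3`). Hence, next to p546152, the regime letter of a `j = 0` class is a pair of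
decidable congruences BY NAME: N = (`3`-adic criterion) ∧ (away congruence), V = (`3`-adic
criterion) ∧ ¬(away congruence), T = ¬(`3`-adic criterion); and the child-N consumer reads
«Mordell datum + two congruences + (R-EU)₃ ⟹ BSD(W, 3)»
(`bsdp_three_of_ellipticUnitIndexAtThree_of_congruences`). The residual (R-EU)₃ is untouched.
Theorems only; no named fact; nothing about any particular curve. beyond-print: NO (Silverman
Exercise 3.7, Serre II.3.3, Tate's algorithm; the organisation is the cell's).

## Contents
§1 `noThreeTorsion_mordellCurve_iff_of_sq_eq_neg_three` (`√−3 ∈ F`: `E_D(F)[3] = 0 ⟺ D ∉ F²`);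
§2 `ne_two_and_mod_three_of_sq_eq_neg_three_padic` / `exists_sq_eq_neg_three_padic`
(`√−3 ∈ ℚ_ℓ ⟺ ℓ ≡ 1 (mod 3)`, `ℓ ≠ 3`); §3 `isSquare_intCast_padic_iff_of_ne_two` (`ℓᵃ·m ∈ ℚ_ℓײ ⟺ a`
even `∧ m` a residue); §4 `noThreeTorsion_padic_iff_of_mordell_model` / `_of_decomp`; §5 THE AWAY
BINDER `away_binder_of_mordell_model` (+ `dvd_of_not_good_of_mordell_model`,
`away_congruence_of_sq_not_dvd`); §6 THE V-WITNESS `vWitness_of_mordell_model`; §7 CONSUMER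
`bsdp_three_of_ellipticUnitIndexAtThree_of_congruences`.

References: ty2 `X12/O11/RamifiedStrictDescentAtThreeLeaf.lean`; `X12/JZeroThreeTorsionCriterion.lean`;
[cite: SilvermanAEC2009, Exercise 3.7 and VII.5 Prop. 5.1]; [cite: Serre1973, Ch. II §3.3 Thm 3, Thm 4];
[cite: SilvermanATAEC1994, IV.9.4 and Table 4.1]; [cite: HardyWright2008, Thm 96].
-/

set_option linter.dupNamespace false
set_option autoImplicit false
noncomputable section

open scoped Classical
open WeierstrassCurve Literature.NumberTheory.EllipticCurves
  Literature.NumberTheory.EllipticCurves.Rank1Residual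
  Summit.BirchSwinnertonDyer.Rank1Residual Summit.BirchSwinnertonDyer.Rank1Residual.X12
  Summit.BirchSwinnertonDyer.Rank1Residual.GaloisImage

namespace Summit.BirchSwinnertonDyer.BirchSwinnertonDyer.Theorems.PrintCFram

/-! ## §1 Over a field containing `√−3`: `E_D(F)[3] = 0 ⟺ D ∉ F²` -/

section FieldLevel

variable {F : Type*} [Field F] [CharZero F]

/-- **`3`-torsion of `y² = x³ + D` over a field containing `√−3`** (`D ≠ 0`, characteristic `0`):
there is NO point of order `3` iff `D` is not a square. (Points of order `3` have `x = 0, y² = D` or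
`x³ = −4D, y² = −3D`; with `θ² = −3` the condition `−3D ∈ F²` is `D ∈ F²`, so the cube condition is
irrelevant.) [cite: SilvermanAEC2009, Exercise 3.7] -/
theorem noThreeTorsion_mordellCurve_iff_of_sq_eq_neg_three {D θ : F} (hD : D ≠ 0)
    (hθ : θ ^ 2 = -3) :
    (∀ P : (mordellCurve D).toAffine.Point, (3 : ℕ) • P = 0 → P = 0) ↔ ¬ IsSquare D := by
  rw [JZeroThree.forall_three_nsmul_iff_not_exists,
    JZeroThree.exists_three_torsion_mordellCurve_iff hD]
  have hθ0 : θ ≠ 0 := by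
    rintro rfl
    norm_num at hθ
  have e : IsSquare (-3 * D) ↔ IsSquare D := by
    rw [← hθ, JZeroThree.isSquare_mul_sq_iff' hθ0]
  rw [e]
  tauto

/-- With `√−3 ∈ F` and `D ∈ F²`, `D ≠ 0`: `y² = x³ + D` HAS a point of order `3` (namely `(0, √D)`).
[cite: SilvermanAEC2009, Exercise 3.7] -/
theorem exists_three_torsion_mordellCurve_of_isSquare {D : F} (hD : D ≠ 0) (hsq : IsSquare D) :
    ∃ P : (mordellCurve D).toAffine.Point, P ≠ 0 ∧ (3 : ℕ) • P = 0 :=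
  (JZeroThree.exists_three_torsion_mordellCurve_iff hD).mpr (Or.inl hsq)

end FieldLevel

/-! ## §2 `√−3 ∈ ℚ_ℓ` ⟺ `ℓ ≡ 1 (mod 3)` (for `ℓ ≠ 3`) -/

section SqrtNegThree

/-- **If `√−3 ∈ ℚ_ℓ` and `ℓ ≠ 3` then `ℓ ≠ 2` and `ℓ ≡ 1 (mod 3)`**: a `2`-adic unit square is
`≡ 1 (mod 8)` while `−3 ≡ 5`; for `ℓ > 3` the square reduces to a square `−3 (mod ℓ)`, and
`(−3/ℓ) = 1 ⟺ ℓ ≡ 1 (mod 6)` (Hardy–Wright Thm 96). [cite: Serre1973, Ch. II §3.3 Thm 3, Thm 4]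
[cite: HardyWright2008, Thm 96] -/
theorem ne_two_and_mod_three_of_sq_eq_neg_three_padic {ℓ : ℕ} [Fact ℓ.Prime] (hℓ3 : ℓ ≠ 3)
    (h : ∃ y : ℚ_[ℓ], y ^ 2 = -3) : ℓ ≠ 2 ∧ ℓ % 3 = 1 := by
  have hℓP : ℓ.Prime := Fact.out
  obtain ⟨y, hy⟩ := h
  have hsq : IsSquare (((-3 : ℤ)) : ℚ_[ℓ]) := ⟨y, by push_cast; rw [← sq, hy]⟩
  have hℓ2 : ℓ ≠ 2 := by
    rintro rfl
    have h8 := PadicSquareClass.emod_eight_eq_one_of_isSquare_padicTwo (u := -3) (by decide) hsq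
    omega
  have hlt : 3 < ℓ := by
    have h2 := hℓP.two_le
    omega
  have hz : IsSquare ((-3 : ℤ) : ZMod ℓ) := DeuringLadic.isSquare_zmod_of_isSquare_padic hsq
  have hz' : IsSquare (-3 : ZMod ℓ) := by simpa using hz
  have h6 := (Literature.NumberTheory.Congruences.SmallQuadraticResidues.isSquare_neg_three_iff
    (p := ℓ) hlt).mp hz'
  exact ⟨hℓ2, by omega⟩

/-- **Conversely `ℓ ≡ 1 (mod 3)` prime ⟹ `√−3 ∈ ℚ_ℓ`** (`−3` is a residue mod `ℓ`, Hensel).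
[cite: HardyWright2008, Thm 96] [cite: Serre1973, Ch. II §3.3 Thm 3] -/
theorem exists_sq_eq_neg_three_padic {ℓ : ℕ} [Fact ℓ.Prime] (h1 : ℓ % 3 = 1) :
    ∃ y : ℚ_[ℓ], y ^ 2 = -3 := by
  have hℓP : ℓ.Prime := Fact.out
  have h2 := hℓP.two_le
  have hℓ2 : ℓ ≠ 2 := by omega
  have hlt : 3 < ℓ := by
    rcases Nat.lt_or_ge 3 ℓ with h | h
    · exact h
    · interval_cases ℓ <;> simp_all
  have hodd : ℓ % 2 = 1 := (Nat.Prime.mod_two_eq_one_iff_ne_two hℓP).mpr hℓ2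
  have h6 : ℓ % 6 = 1 := by omega
  have hz' : IsSquare (-3 : ZMod ℓ) :=
    (Literature.NumberTheory.Congruences.SmallQuadraticResidues.isSquare_neg_three_iff
      (p := ℓ) hlt).mpr h6
  have hz : IsSquare ((-3 : ℤ) : ZMod ℓ) := by simpa using hz'
  have hnd : ¬ (ℓ : ℤ) ∣ (-3 : ℤ) := by
    rw [dvd_neg]
    intro h
    have h' : ℓ ∣ 3 := by exact_mod_cast h
    have := (Nat.prime_dvd_prime_iff_eq hℓP Nat.prime_three).mp h'
    omega
  obtain ⟨s, hs⟩ := PadicSquareClass.isSquare_intCast_padic_of_isSquare_zmod (p := ℓ) hℓ2 hnd hz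
  exact ⟨s, by rw [sq, ← hs]; push_cast; ring⟩

end SqrtNegThree

/-! ## §3 Square classes of `ℓᵃ·m` in `ℚ_ℓ`, odd `ℓ` -/

section Squares

/-- **Squares in `ℚ_ℓ`, `ℓ` odd:** for `ℓ ∤ m`, `ℓᵃ·m` is a square in `ℚ_ℓ` iff `a` is even and `m` is
a quadratic residue mod `ℓ` (Serre II.3.3 Thm 3; tree `PadicSquareClass.even_and_isSquare_unit_of_isSquare`,
`…isSquare_intCast_padic_of_isSquare_zmod`, `DeuringLadic.isSquare_zmod_of_isSquare_padic`).
[cite: Serre1973, Ch. II §3.3 Thm 3] -/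
theorem isSquare_intCast_padic_iff_of_ne_two {ℓ : ℕ} [Fact ℓ.Prime] (hℓ2 : ℓ ≠ 2) {a : ℕ} {m : ℤ}
    (hm : ¬ (ℓ : ℤ) ∣ m) :
    IsSquare (((((ℓ : ℤ) ^ a * m : ℤ)) : ℚ_[ℓ])) ↔ Even a ∧ IsSquare ((m : ℤ) : ZMod ℓ) := by
  constructor
  · intro h
    obtain ⟨ha, hu⟩ :=
      PadicSquareClass.even_and_isSquare_unit_of_isSquare (p := ℓ) (n := (ℓ : ℤ) ^ a * m) rfl hm h
    exact ⟨Nat.even_iff.mpr ha, DeuringLadic.isSquare_zmod_of_isSquare_padic hu⟩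
  · rintro ⟨⟨b, hb⟩, hsq⟩
    obtain ⟨s, hs⟩ := PadicSquareClass.isSquare_intCast_padic_of_isSquare_zmod (p := ℓ) hℓ2 hm hsq
    refine ⟨(ℓ : ℚ_[ℓ]) ^ b * s, ?_⟩
    push_cast
    rw [hb, pow_add, hs]
    ring

end Squares

/-! ## §4 Models over `ℚ`: `W(ℚ_ℓ)[3] = 0 ⟺ k ∉ ℚ_ℓײ` for `W ≅ y² = x³ + k`, `√−3 ∈ ℚ_ℓ` -/

section Models

/-- **For ANY model `W` of `y² = x³ + k` (`C • W = E_k`, `k ≠ 0`) and any prime `ℓ` with `√−3 ∈ ℚ_ℓ`: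
`W(ℚ_ℓ)[3] = 0 ⟺ k ∉ ℚ_ℓײ`** (the binder is model-invariant, `JZeroThree.noThreeTorsion_baseChange_iff_of_smul_eq`;
then §1). [cite: SilvermanAEC2009, Exercise 3.7] -/
theorem noThreeTorsion_padic_iff_of_mordell_model {W : WeierstrassCurve ℚ} {C : VariableChange ℚ}
    {k : ℤ} (hk : k ≠ 0) (hW : C • W = mordellCurve ((k : ℤ) : ℚ)) {ℓ : ℕ} [Fact ℓ.Prime]
    (hθ : ∃ y : ℚ_[ℓ], y ^ 2 = -3) :
    (∀ Q : (W.baseChange ℚ_[ℓ]).toAffine.Point, (3 : ℕ) • Q = 0 → Q = 0) ↔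
      ¬ IsSquare (((k : ℤ)) : ℚ_[ℓ]) := by
  have h1 := JZeroThree.noThreeTorsion_baseChange_iff_of_smul_eq hW ℚ_[ℓ]
  rw [mordellCurve_baseChange, map_intCast] at h1
  rw [h1]
  obtain ⟨y, hy⟩ := hθ
  have hk' : (((k : ℤ)) : ℚ_[ℓ]) ≠ 0 := by exact_mod_cast hk
  exact noThreeTorsion_mordellCurve_iff_of_sq_eq_neg_three hk' hy

/-- **The same, read on a decomposition `k = ℓᵃ·m`, `ℓ ∤ m`** (`ℓ ≠ 3`, `√−3 ∈ ℚ_ℓ`, hence `ℓ` odd):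
`W(ℚ_ℓ)[3] = 0 ⟺ a` odd `∨ m` a non-residue mod `ℓ`. [cite: SilvermanAEC2009, Exercise 3.7]
[cite: Serre1973, Ch. II §3.3 Thm 3] -/
theorem noThreeTorsion_padic_iff_of_decomp {W : WeierstrassCurve ℚ} {C : VariableChange ℚ}
    {ℓ : ℕ} [Fact ℓ.Prime] (hℓ3 : ℓ ≠ 3) (hθ : ∃ y : ℚ_[ℓ], y ^ 2 = -3) {a : ℕ} {m : ℤ}
    (hm : ¬ (ℓ : ℤ) ∣ m) (hW : C • W = mordellCurve ((((ℓ : ℤ) ^ a * m : ℤ)) : ℚ)) :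
    (∀ Q : (W.baseChange ℚ_[ℓ]).toAffine.Point, (3 : ℕ) • Q = 0 → Q = 0) ↔
      (Odd a ∨ ¬ IsSquare ((m : ℤ) : ZMod ℓ)) := by
  have hℓ2 : ℓ ≠ 2 := (ne_two_and_mod_three_of_sq_eq_neg_three_padic hℓ3 hθ).1
  have hm0 : m ≠ 0 := fun h => hm (h ▸ dvd_zero _)
  have hk : (ℓ : ℤ) ^ a * m ≠ 0 :=
    mul_ne_zero (pow_ne_zero _ (by exact_mod_cast (Fact.out : ℓ.Prime).ne_zero)) hm0
  rw [noThreeTorsion_padic_iff_of_mordell_model hk hW hθ, isSquare_intCast_padic_iff_of_ne_two hℓ2 hm,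
    not_and_or, Nat.not_even_iff_odd]

end Models

/-! ## §5 The away binder `hℓ` from a congruence on `k` -/

section Away

/-- **A bad prime `ℓ ≠ 3` of `W ≅ y² = x³ + k` with `√−3 ∈ ℚ_ℓ` divides `k`**: `√−3 ∈ ℚ_ℓ` forces
`ℓ ≠ 2`, and `y² = x³ + k` has good reduction at every `ℓ ∤ 6k` (`hasGoodReductionAtPrime_mordellCurve`),
good reduction being model-invariant (`BSZLemma17.hasGoodReductionAtPrime_smul_iff`).
[cite: SilvermanAEC2009, VII.5 Prop. 5.1 and VII.1 Prop. 1.3(b)] -/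
theorem dvd_of_not_good_of_mordell_model {W : WeierstrassCurve ℚ} {C : VariableChange ℚ} {k : ℤ}
    (hW : C • W = mordellCurve ((k : ℤ) : ℚ)) {ℓ : ℕ} [Fact ℓ.Prime] (hℓ3 : ℓ ≠ 3)
    (hθ : ∃ y : ℚ_[ℓ], y ^ 2 = -3) (hbad : ¬ Good W ℓ) : (ℓ : ℤ) ∣ k := by
  have hℓP : ℓ.Prime := Fact.out
  have hℓZ : Prime (ℓ : ℤ) := Nat.prime_iff_prime_int.mp hℓP
  have hℓ2 : ℓ ≠ 2 := (ne_two_and_mod_three_of_sq_eq_neg_three_padic hℓ3 hθ).1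
  by_contra hnd
  apply hbad
  have h6 : ¬ (ℓ : ℤ) ∣ 6 * k := by
    intro h
    rcases hℓZ.dvd_or_dvd h with h6 | hk
    · have h6' : ℓ ∣ 6 := by exact_mod_cast h6
      have hle : ℓ ≤ 6 := Nat.le_of_dvd (by norm_num) h6'
      have h2 := hℓP.two_le
      interval_cases ℓ <;> simp_all (config := {decide := true})
    · exact hnd hk
  have hg : (mordellCurve ((k : ℤ) : ℚ)).HasGoodReductionAtPrime ℓ :=
    hasGoodReductionAtPrime_mordellCurve h6
  rw [← hW] at hg
  exact (BSZLemma17.hasGoodReductionAtPrime_smul_iff W C ℓ).mp hg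

/-- **THE AWAY BINDER AS A CONGRUENCE.** Let `W` be any model of `y² = x³ + k` (`C • W = E_k`,
`k ∈ ℤ ∖ {0}`). Suppose that for every prime `ℓ ≡ 1 (mod 3)` dividing `k`, either `v_ℓ(k)` is odd or
`k / ℓ^{v_ℓ(k)}` is a quadratic non-residue mod `ℓ`. Then ty2's away binder holds: at every prime
`ℓ ≠ 3` with `√−3 ∈ ℚ_ℓ` at which `W` is bad, `W(ℚ_ℓ)[3] = 0`. (At the primes `ℓ ≡ 1 (mod 3)` not
dividing `k` the curve is good; `2` and the primes `ℓ ≡ 2 (mod 3)` impose nothing.) This is the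
hypothesis «`3 ∤ c_ℓ(W)` at every bad `ℓ ≡ 1 (mod 3)`» of regime N, decided on `k`.
[cite: SilvermanAEC2009, Exercise 3.7 and VII.5 Prop. 5.1] [cite: Serre1973, Ch. II §3.3 Thm 3] -/
theorem away_binder_of_mordell_model {W : WeierstrassCurve ℚ} {C : VariableChange ℚ} {k : ℤ}
    (hk : k ≠ 0) (hW : C • W = mordellCurve ((k : ℤ) : ℚ))
    (hcong : ∀ ℓ : ℕ, ℓ.Prime → (ℓ : ℤ) ∣ k → ℓ % 3 = 1 →
      Odd (padicValInt ℓ k) ∨ ¬ IsSquare (((k / (ℓ : ℤ) ^ padicValInt ℓ k : ℤ)) : ZMod ℓ)) :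
    ∀ (ℓ : ℕ) [Fact ℓ.Prime], ℓ ≠ 3 → (∃ y : ℚ_[ℓ], y ^ 2 = -3) → ¬ Good W ℓ →
      ∀ Q : (W.baseChange ℚ_[ℓ]).toAffine.Point, (3 : ℕ) • Q = 0 → Q = 0 := by
  intro ℓ _ hℓ3 hθ hbad
  have hℓP : ℓ.Prime := Fact.out
  have hℓ1 : ℓ % 3 = 1 := (ne_two_and_mod_three_of_sq_eq_neg_three_padic hℓ3 hθ).2
  have hℓk : (ℓ : ℤ) ∣ k := dvd_of_not_good_of_mordell_model hW hℓ3 hθ hbad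
  -- `k = ℓᵃ·m`, `ℓ ∤ m`
  set a : ℕ := padicValInt ℓ k with ha
  obtain ⟨m, hkm⟩ : ∃ m : ℤ, k = (ℓ : ℤ) ^ a * m := ha ▸ padicValInt_dvd k
  have hℓm : ¬ (ℓ : ℤ) ∣ m := by
    rintro ⟨m', rfl⟩
    have hdvd : (ℓ : ℤ) ^ (a + 1) ∣ k := ⟨m', by rw [hkm]; ring⟩
    rcases (padicValInt_dvd_iff (p := ℓ) (a + 1) k).mp hdvd with h | h
    · exact hk h
    · omega
  have hdiv : k / (ℓ : ℤ) ^ a = m := by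
    rw [hkm, Int.mul_ediv_cancel_left _ (pow_ne_zero _ (by exact_mod_cast hℓP.ne_zero))]
  have hc := hcong ℓ hℓP hℓk hℓ1
  rw [hdiv] at hc
  rw [hkm] at hW
  exact (noThreeTorsion_padic_iff_of_decomp hℓ3 hθ hℓm hW).mpr hc

/-- **Coefficients with no square factor `ℓ²`, `ℓ ≡ 1 (mod 3)`, satisfy the away congruence outright**
(`v_ℓ(k) = 1` is odd). E.g. Kriz–Li's sextic twists `y² = x³ − 432d`, `d` square-free: every
`ℓ ≡ 1 (mod 3)` dividing `k = −2⁴·3³·d` divides `d` exactly once — these classes are never in regime V.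
[folklore] -/
theorem away_congruence_of_sq_not_dvd {k : ℤ}
    (h : ∀ ℓ : ℕ, ℓ.Prime → ℓ % 3 = 1 → (ℓ : ℤ) ∣ k → ¬ (ℓ : ℤ) ^ 2 ∣ k) :
    ∀ ℓ : ℕ, ℓ.Prime → (ℓ : ℤ) ∣ k → ℓ % 3 = 1 →
      Odd (padicValInt ℓ k) ∨ ¬ IsSquare (((k / (ℓ : ℤ) ^ padicValInt ℓ k : ℤ)) : ZMod ℓ) := by
  intro ℓ hℓ hℓk h1
  haveI : Fact ℓ.Prime := ⟨hℓ⟩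
  left
  have h2 := h ℓ hℓ h1 hℓk
  have hv1 : 1 ≤ padicValInt ℓ k := by
    rcases (padicValInt_dvd_iff (p := ℓ) 1 k).mp (by simpa using hℓk) with h0 | h0
    · exact absurd (h0 ▸ dvd_zero _) h2
    · exact h0
  have hv2 : padicValInt ℓ k < 2 := by
    by_contra hge
    exact h2 (dvd_trans (pow_dvd_pow (ℓ : ℤ) (by omega)) (padicValInt_dvd k))
  have : padicValInt ℓ k = 1 := by omega
  rw [this]
  exact odd_one

end Away

/-! ## §6 The regime-V witness at a prime `ℓ ≡ 1 (mod 3)` -/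

section VWitness

/-- **THE V-WITNESS.** Let `W` be any ELLIPTIC model of `y² = x³ + ℓᵃ·m` with `ℓ ≡ 1 (mod 3)` prime,
`ℓ ∤ m`, `a ∈ {2, 4}` (stated: `1 ≤ a ≤ 5`, `a` even) and `m` a quadratic residue mod `ℓ`. Then `W` is
BAD at `ℓ` (Tate's algorithm: `ℓ ∣ k`, `ℓ⁶ ∤ k`, type IV / IV*; p3's
`not_hasGoodReductionAtPrime_of_dvd_mordell`) and `W(ℚ_ℓ)` HAS a point of order `3` (`k ∈ ℚ_ℓײ`,
`√−3 ∈ ℚ_ℓ`) — so ty2's away binder FAILS at `ℓ` and the class lies in regime V (`3 ∣ c_ℓ(W)`).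
[cite: SilvermanATAEC1994, IV.9.4 and Table 4.1] [cite: SilvermanAEC2009, Exercise 3.7]
[cite: Serre1973, Ch. II §3.3 Thm 3] -/
theorem vWitness_of_mordell_model (W : WeierstrassCurve ℚ) [W.IsElliptic] {C : VariableChange ℚ}
    {ℓ : ℕ} [Fact ℓ.Prime] (hℓ1 : ℓ % 3 = 1) {a : ℕ} {m : ℤ} (hm : ¬ (ℓ : ℤ) ∣ m)
    (ha1 : 1 ≤ a) (ha5 : a ≤ 5) (ha : Even a) (hsq : IsSquare ((m : ℤ) : ZMod ℓ))
    (hW : C • W = mordellCurve ((((ℓ : ℤ) ^ a * m : ℤ)) : ℚ)) :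
    ¬ Good W ℓ ∧ ∃ Q : (W.baseChange ℚ_[ℓ]).toAffine.Point, (3 : ℕ) • Q = 0 ∧ Q ≠ 0 := by
  have hℓP : ℓ.Prime := Fact.out
  have h2 := hℓP.two_le
  have hℓ3 : ℓ ≠ 3 := by omega
  have hℓ5 : 5 ≤ ℓ := by
    by_contra h
    interval_cases ℓ <;> simp_all (config := {decide := true})
  have hℓ0 : (ℓ : ℤ) ≠ 0 := by exact_mod_cast hℓP.ne_zero
  have hθ : ∃ y : ℚ_[ℓ], y ^ 2 = -3 := exists_sq_eq_neg_three_padic hℓ1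
  refine ⟨?_, ?_⟩
  · -- bad at `ℓ`: `ℓ ∣ k`, `ℓ⁶ ∤ k`
    have hk1 : (ℓ : ℤ) ∣ (ℓ : ℤ) ^ a * m :=
      dvd_mul_of_dvd_left (dvd_pow_self _ (by omega)) _
    have hk6 : ¬ (ℓ : ℤ) ^ 6 ∣ (ℓ : ℤ) ^ a * m := by
      intro h6
      have hsplit : (ℓ : ℤ) ^ 6 = (ℓ : ℤ) ^ a * (ℓ : ℤ) ^ (6 - a) := by
        rw [← pow_add]; congr 1; omega
      rw [hsplit] at h6
      have h' : (ℓ : ℤ) ^ (6 - a) ∣ m := (mul_dvd_mul_iff_left (pow_ne_zero _ hℓ0)).mp h6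
      exact hm (dvd_trans (dvd_pow_self _ (by omega)) h')
    exact not_hasGoodReductionAtPrime_of_dvd_mordell W ⟨C, hW⟩ ℓ hℓ5 hk1 hk6
  · -- a point of order `3` over `ℚ_ℓ`
    have hnot : ¬ (∀ Q : (W.baseChange ℚ_[ℓ]).toAffine.Point, (3 : ℕ) • Q = 0 → Q = 0) := by
      rw [noThreeTorsion_padic_iff_of_decomp hℓ3 hθ hm hW, not_or, Nat.not_odd_iff_even, not_not]
      exact ⟨ha, hsq⟩
    rw [JZeroThree.forall_three_nsmul_iff_not_exists, not_not] at hnot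
    obtain ⟨Q, hQ0, hQ3⟩ := hnot
    exact ⟨Q, hQ3, hQ0⟩

end VWitness

/-! ## §7 Consumer: regime N from (R-EU)₃ with all three local binders decided by congruences -/

section Consumer

/-- **REGIME N OF THE CRUX C1, MEMBER BY MEMBER, WITH ALL THREE LOCAL BINDERS DISCHARGED BY
CONGRUENCES.** Let `W/ℚ` be globally minimal with a Mordell model `C • W = (y² = x³ + k)`,
`k = 3ᵃ·m`, `3 ∤ m`, of analytic rank one, such that
(i) `(a even ∧ m ≡ 2 (mod 3)) ∨ (a odd ∧ m ≡ 1 (mod 3))` (⟺ `W(ℚ₃)[3] = 0 ∧ W^{(−3)}(ℚ₃)[3] = 0`,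
p546152), and (ii) for every prime `ℓ ≡ 1 (mod 3)` dividing `k`, `v_ℓ(k)` is odd or
`k/ℓ^{v_ℓ(k)}` is a non-residue mod `ℓ` (⟺ the away binder, §5). Then (R-EU)₃ at `W` (`h3`, the
residual, OPEN) gives `BSD(W, 3)` — granted modularity, Gross–Zagier I.(7.3), GZK and Cassels
(ty2 `X12.O11.bsdp_three_of_ellipticUnitIndexAtThree`). CM and `3`-ramified come from `j = 0`.
Nothing asserted about any curve. [cite: Miller2011LMS, §1 and Def. 1.1] [cite: SilvermanAEC2009, Exercise 3.7]
[cite: Serre1973, Ch. II §3.3 Thm 3] -/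
theorem bsdp_three_of_ellipticUnitIndexAtThree_of_congruences
    (hmod : hasEntireLFunction_rat) (hGZ : GrossZagier1986_thm_I_7_3)
    (hGZK : rank_eq_analyticRank_of_analyticRank_le_one) (hCassels : bsdRHS_eq_of_isIsogenous)
    {W : WeierstrassCurve ℚ} [W.IsElliptic] [W.IsGloballyMinimal] {C : VariableChange ℚ}
    {k : ℤ} {a : ℕ} {m : ℤ} (hm : ¬ (3 : ℤ) ∣ m) (hkam : k = (3 : ℤ) ^ a * m)
    (hW : C • W = mordellCurve ((k : ℤ) : ℚ))
    (hcrit : (Even a ∧ (m : ZMod 3) = 2) ∨ (Odd a ∧ (m : ZMod 3) = 1))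
    (hcong : ∀ ℓ : ℕ, ℓ.Prime → (ℓ : ℤ) ∣ k → ℓ % 3 = 1 →
      Odd (padicValInt ℓ k) ∨ ¬ IsSquare (((k / (ℓ : ℤ) ^ padicValInt ℓ k : ℤ)) : ZMod ℓ))
    (hr : W.analyticRank = 1)
    (h3 : O11.RamifiedCMEllipticUnitIndexAtThree W) : BSDp W 3 := by
  have hm0 : m ≠ 0 := fun h => hm (h ▸ dvd_zero 3)
  have hk : k ≠ 0 := by
    rw [hkam]; exact mul_ne_zero (pow_ne_zero _ (by norm_num)) hm0
  -- `j = 0` (`c₄(y² = x³ + k) = 0`, `c₄` a semi-invariant)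
  have hj : W.j = 0 := by
    apply j_eq_zero
    have h := variableChange_c₄ W C
    rw [hW, mordellCurve_c₄] at h
    have hu : ((C.u⁻¹ : ℚˣ) : ℚ) ^ 4 ≠ 0 := pow_ne_zero _ (Units.ne_zero _)
    rcases mul_eq_zero.mp h.symm with h0 | h0
    · exact (hu h0).elim
    · exact h0
  have hW' : C • W = mordellCurve ((((3 : ℤ) ^ a * m : ℤ)) : ℚ) := by rw [hW, hkam]
  obtain ⟨htors, htw⟩ := (JZeroThree.noThreeTorsion_pair_iff_of_mordell_model W hm hW').mpr hcrit
  exact O11.bsdp_three_of_ellipticUnitIndexAtThree hmod hGZ hGZK hCassels (W.hasCM_of_j_eq_zero hj)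
    (JZeroThree.cmRamified_three_of_j_eq_zero W hj) hr htors htw
    (away_binder_of_mordell_model hk hW hcong) h3

end Consumer

end Summit.BirchSwinnertonDyer.BirchSwinnertonDyer.Theorems.PrintCFram

end
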